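import Summits.ValiantsHypothesis.ValiantsHypothesis.Theorems.BarrierLeverPartitionMinorsHitByVPHiddenStatesBallCutCertKitFast

/-!
# Route BarrierLever — item `PartitionMinorsHitByVP` (stmt-ValiantsHypothesis-19717), line `hidden-states`:
# ★★ THE CORES OF THE t = 4 CHART OF THE THIRD SHELL (support 14, part 2) — 3 totally unbalanced 3-swap classes served for every `h` (support 14: classes 4–6 of 9)

Helper file (`--supports stmt-ValiantsHypothesis-19717`, `--computational`; cell valiant-natproofs, 𝒟-side door (c), registered line
`Cruxes/PartitionMinorsHitByVP/Lines/hidden_states.lean` v10; prover seat val-np-p6 gen 22; planner SUCCESSOR MANDATE STATUS l.1830 (P2)).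
Closes NO item.  WHAT IS CHECKED: the CORES (classes without a g20 path certificate) of the chart of ALL totally unbalanced 3-swap families at `t = 4` up to
isomorphism (val-np-p6 g22 kit j333365: 607 994 classes, supports 6 … 27, 607 565 path-certified, 429 CORES of supports 6 … 15;
HOME/val-np-p6/g22/kit/cores_t4.txt, j333365.chart4-t4.stdout.log), restricted to the blocks
named in the title; each class is six naturals (binary codes of `A_0, A_1, A_2, C_0, C_1, C_2`) inside ONE string literal per block
(`level4Data_n_i`), one `native_decide` per block runs `certCheckList3N` (`…BallCutCertKitFast`: shape check + fast canonical table at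
`stdTable s n` mod 65521 + packed LU + val-np-p4 g30's verified checkers), and `exists_table_of_mem_parseClassesN` serves every coded class
for every `h` (`level4_served_n_i`).  HONEST LABEL: computational lane (`Lean.ofReduceBool`); «`S₃` at `t = 4` for every `h`» needs all
supports (same recipe: HOME/val-np-p6/g22/kit/gen_level_str.py) and the CLASSIFICATION as a Lean theorem; 19717 stays OPEN; nothing on
crux 14610 or VP ≠ VNP.
-/

set_option linter.dupNamespace false

namespace Summit.ValiantsHypothesis.ValiantsHypothesis.Theorems.BarrierLever.HiddenStates

open Finset

namespace BallCut

open SymbJoin MoorePeel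

/-- The t = 4 chart, support 14, classes 4–6 (of 9), coded: six naturals per class. -/
def level4Data_14_3 : String := "
15360 12312 3096 992 10262 5641  15360 2160 778 13184 9740 5385  15360 2656 612 13184 9304 5155
"

/-- **CERTIFICATE CHECK** for `level4Data_14_3` (3 classes, `1471 × 1471` matrices, seed 7; computational, `Lean.ofReduceBool`). -/
theorem level4Data_14_3_check : certCheckList3N 14 4 7 65521 (parseClasses level4Data_14_3) = true := by
  native_decide

/-- ★ Every class coded in `level4Data_14_3` is served, for every `h`. -/
theorem level4_served_14_3 (e : ℕ × ℕ × ℕ × ℕ × ℕ × ℕ) (he : e ∈ parseClasses level4Data_14_3) {h : ℕ} (σ : Fin 14 ↪ Fin h)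
    {r : ℕ} (u cols : Fin r → Finset (Fin h)) (hu : Function.Injective u)
    (hU : ∀ i, ((u i).card ≤ 4 ∧ ∀ j, u i ≠ (codedA 14 e j).map σ) ∨ ∃ j, u i = (codedC 14 e j).map σ)
    (hcols : ∀ J : Finset (Fin h), J.card ≤ 4 → ∃ k, cols k = J) :
    ∃ tx : Option (Fin h) → Fin h → ℂ,
      (Matrix.of fun i k : Fin r => ∏ a ∈ u i, (tx none a + ∑ q ∈ cols k, tx (some q) a)).det ≠ 0 :=
  exists_table_of_mem_parseClassesN 14 4 7 prime_65521 (by norm_num [packBase]) _ level4Data_14_3_check e he σ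
    u cols hu hU hcols

end BallCut

end Summit.ValiantsHypothesis.ValiantsHypothesis.Theorems.BarrierLever.HiddenStates
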